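import Mathlib
import HarnessLib
import Summits.ValiantsHypothesis.ValiantsHypothesis.Theorems.LacunarySymmetroidMatrixDescartesProductPlusOneRowTowerKLine
import Summits.ValiantsHypothesis.ValiantsHypothesis.Theorems.LacunarySymmetroidMatrixDescartesProductPlusOneSlowKneeCellRateFreeEuler

/-!
# LINE (A) `product_plus_one` (crux `MatrixDescartes`, stmt-ValiantsHypothesis-18050, V1) — W-CB: ★★ the RATE-FREE SLOW-KNEE CELL FOR EVERY SUPPORT SIZE K

Owner memo `pub/ideators/val-idea-25/NOTE-idea25g3-18050-LINEA-AB-reduction.md` §19–§24 (W-CB, `K^> = 0`: «knees not faster than the poles never split a window»).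
Support `d : Fin (n+2) → ℕ` strictly increasing (ANY `K = n + 2 ≥ 2` letters), base rate `p = d 1 − d 0`; rows `f_j = Σ_l C (a j l) X^{d l}`, window `(u,v)`, `0 < u`.
MENU (each row): (B) a BINOMIAL on the pair `(d 0, d l₀.succ)` — any signs if it is the slow pair (`l₀ = 0`: slow knees and slow pullers), a POLE
(`a_{j0}·a_{j,l₀+1} < 0`) for the other pairs — whose root (if any) is not in `(u,v)` (`0 ≤ f_j(u)·f_j(v)`); or (C) an UNSWITCHED INCOHERENT K-NOMIAL
(`a_{j0} > 0`, all `a_{j,l+1} ≤ 0`, `Σ_l a_{j,l+1} < 0`, `f_j(v) > 0`).  Then `W(∏_j f_j) = P·θ(θP) − (θP)²` has AT MOST TWO roots in `(u,v)`, and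
`eulerNumerator d a l₀` at most THREE, for every coupling.  At `K = 3` this is ✓ `slowKneeCellRateFree_wronskian_roots_le_two` minus its `(d1,d2)` rows.

Proof = the θ-shell ✓ `no_three_zeros_of_theta_sq_law` fed with `S = Σ_j ψ₁^{(j)}` (✓ `logWronskian_prodK_eq_rowPsiK1_sum`) and the per-row STRICT law
`p²ψ₁ < ψ₃`: (B) ✓ `rowPsiK3_single_law` (`ψ₃ − λ²ψ₁ = 6ψ₁²`, `λ = d l₀.succ − d 0 ≥ p`) with the sign of `ψ₁` from ✓ `rowPsiK1_single_pos/neg`; (C) ✓ `rowPsiK3_gt`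
(every rate `≥ p`, no gap condition).

* `slowKneeCellEveryK_wronskian_no_three_zeros` (three-point form, `0 < m`), ★★ `slowKneeCellEveryK_wronskian_roots_le_two`,
  ★★ `slowKneeCellEveryK_eulerNumerator_roots_le_three`.

Honest framing: ONE W-cell family (K^> = 0 with poles of all rates, every K), helper; the fast-knee cells, `WronskianBudgetK3`, `OneChangeFloorK3`, `stub_classRowK3`,
`stub_polyLaw`, `MatrixDescartes`, B are NOT proved; `VP ≠ VNP` NOT proved.  No definitions, no named facts.
-/

set_option linter.dupNamespace false

namespace Summit.ValiantsHypothesis.ValiantsHypothesis.Theorems.LacunarySymmetroidMatrixDescartes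

namespace ProductPlusOne

open Finset Set Polynomial
open scoped BigOperators Topology Polynomial

/-- ★★ **THE RATE-FREE SLOW-KNEE CELL FOR EVERY K, three-point form** (`0 < m`; menu in the module docstring): `W(∏_j f_j)` does not vanish at three
points `x₁ < x₂ < x₃` of `(u,v)`. [this file's theorem] -/
theorem slowKneeCellEveryK_wronskian_no_three_zeros {m n : ℕ} (hm : 0 < m) (d : Fin (n + 2) → ℕ) (hd : StrictMono d)
    (a : Fin m → Fin (n + 2) → ℝ) {u v : ℝ} (hu : 0 < u)
    (hrow : ∀ j,
      (∃ l₀ : Fin (n + 1), (∀ l, l ≠ l₀ → a j l.succ = 0) ∧ a j 0 ≠ 0 ∧ a j l₀.succ ≠ 0 ∧ (l₀ = 0 ∨ a j 0 * a j l₀.succ < 0) ∧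
          0 ≤ (∑ l, C (a j l) * X ^ (d l) : ℝ[X]).eval u * (∑ l, C (a j l) * X ^ (d l) : ℝ[X]).eval v) ∨
      (0 < a j 0 ∧ (∀ l : Fin (n + 1), a j l.succ ≤ 0) ∧ ∑ l : Fin (n + 1), a j l.succ < 0 ∧
          0 < (∑ l, C (a j l) * X ^ (d l) : ℝ[X]).eval v))
    {x₁ x₂ x₃ : ℝ} (h₁ : x₁ ∈ Ioo u v) (h₃ : x₃ ∈ Ioo u v) (h12' : x₁ < x₂) (h23 : x₂ < x₃)
    (hzero : ∀ x ∈ ({x₁, x₂, x₃} : Set ℝ),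
      ((∏ j, ∑ l, C (a j l) * X ^ (d l) : ℝ[X]) * (X * derivative (X * derivative (∏ j, ∑ l, C (a j l) * X ^ (d l) : ℝ[X])))
        - (X * derivative (∏ j, ∑ l, C (a j l) * X ^ (d l) : ℝ[X])) ^ 2).eval x = 0) : False := by
  classical
  have hd0 : ∀ l, d 0 ≤ d l := fun l => hd.monotone (Fin.zero_le l)
  have hp1 : 1 ≤ d 1 - d 0 := by
    have := hd (show (0 : Fin (n + 2)) < 1 from Fin.zero_lt_one)
    omega
  -- rates of the tail letters and the base rate
  set lam : Fin (n + 1) → ℕ := fun l => d l.succ - d 0 with hlam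
  have hlam_ge : ∀ l : Fin (n + 1), d 1 - d 0 ≤ lam l := by
    intro l
    have : d 1 ≤ d l.succ := hd.monotone (by
      change (1 : Fin (n + 2)) ≤ l.succ
      rw [Fin.le_def]
      simp)
    show d 1 - d 0 ≤ d l.succ - d 0
    omega
  have hlam_ne : ∀ l : Fin (n + 1), lam l ≠ 0 := fun l => by have := hlam_ge l; omega
  have hcast : (((d 1 - d 0 - 1 : ℕ) : ℝ) + 1) = ((d 1 - d 0 : ℕ) : ℝ) := by
    have h : d 1 - d 0 - 1 + 1 = d 1 - d 0 := Nat.sub_add_cancel hp1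
    exact_mod_cast congrArg (fun k : ℕ => (k : ℝ)) h
  have huv : u < v := h₁.1.trans h₁.2
  have hv : 0 < v := hu.trans huv
  have h₂ : x₂ ∈ Ioo u v := ⟨h₁.1.trans h12', h23.trans h₃.2⟩
  have hIoo : ∀ x ∈ ({x₁, x₂, x₃} : Set ℝ), x ∈ Ioo u v := by
    intro x hx
    simp only [Set.mem_insert_iff, Set.mem_singleton_iff] at hx
    rcases hx with h | h | h <;> subst h <;> assumption
  -- the stripped row `g_j(x) = a_{j0} − Σ_l (−a_{j,l+1}) x^{λ_l}`
  have hev : ∀ j x, (∑ l, C (a j l) * X ^ (d l) : ℝ[X]).eval x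
      = x ^ (d 0) * (a j 0 - ∑ l : Fin (n + 1), (-(a j l.succ)) * x ^ (lam l)) := fun j x => eval_rowK_eq d hd0 (a j) x
  -- KEY FACTS per row on the window: non-vanishing of the stripped row and the STRICT rate law
  have hkey : ∀ j, ∀ x ∈ Ioo u v,
      a j 0 - ∑ l : Fin (n + 1), (-(a j l.succ)) * x ^ (lam l) ≠ 0 ∧
      ((d 1 - d 0 : ℕ) : ℝ) ^ 2 * rowPsiK1 lam (a j 0) (fun l : Fin (n + 1) => -(a j l.succ)) x
        < rowPsiK3 lam (a j 0) (fun l : Fin (n + 1) => -(a j l.succ)) x := by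
    intro j x hx
    have hx0 : 0 < x := hu.trans hx.1
    rcases hrow j with ⟨l₀, hzero', h0, hl0, hkind, hend⟩ | ⟨h0, hle, hsum, hvpos⟩
    · -- (B) binomial on the pair (d 0, d l₀.succ)
      have hB : ∀ l, l ≠ l₀ → (fun l : Fin (n + 1) => -(a j l.succ)) l = 0 := fun l hl => by simp [hzero' l hl]
      have hrs := row_single lam (a j 0) (fun l : Fin (n + 1) => -(a j l.succ)) l₀ hB
      -- endpoint signs of the stripped binomial
      have hgu : (∑ l, C (a j l) * X ^ (d l) : ℝ[X]).eval u = u ^ (d 0) * (a j 0 + a j l₀.succ * u ^ (lam l₀)) := by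
        rw [hev, row_single lam (a j 0) (fun l : Fin (n + 1) => -(a j l.succ)) l₀ hB]; ring
      have hgv : (∑ l, C (a j l) * X ^ (d l) : ℝ[X]).eval v = v ^ (d 0) * (a j 0 + a j l₀.succ * v ^ (lam l₀)) := by
        rw [hev, row_single lam (a j 0) (fun l : Fin (n + 1) => -(a j l.succ)) l₀ hB]; ring
      have hend' : 0 ≤ (a j 0 + a j l₀.succ * u ^ (lam l₀)) * (a j 0 + a j l₀.succ * v ^ (lam l₀)) := by
        rw [hgu, hgv] at hend
        have hpow : 0 < u ^ (d 0) * v ^ (d 0) := mul_pos (pow_pos hu _) (pow_pos hv _)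
        have : u ^ (d 0) * (a j 0 + a j l₀.succ * u ^ (lam l₀)) * (v ^ (d 0) * (a j 0 + a j l₀.succ * v ^ (lam l₀)))
            = (u ^ (d 0) * v ^ (d 0)) * ((a j 0 + a j l₀.succ * u ^ (lam l₀)) * (a j 0 + a j l₀.succ * v ^ (lam l₀))) := by ring
        rw [this] at hend
        exact (mul_nonneg_iff_of_pos_left hpow).1 hend
      have hne : a j 0 + a j l₀.succ * x ^ (lam l₀) ≠ 0 :=
        binomial_ne_zero_of_endpoints (a j 0) (a j l₀.succ) (hlam_ne l₀) hu hx hend' hl0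
      have hF : a j 0 - ∑ l : Fin (n + 1), (-(a j l.succ)) * x ^ (lam l) ≠ 0 := by
        rw [hrs]
        have : a j 0 - -(a j l₀.succ) * x ^ (lam l₀) = a j 0 + a j l₀.succ * x ^ (lam l₀) := by ring
        rwa [this]
      refine ⟨hF, ?_⟩
      have hlaw := rowPsiK3_single_law lam (a j 0) (fun l : Fin (n + 1) => -(a j l.succ)) l₀ hB x
      have hlam0 : ((d 1 - d 0 : ℕ) : ℝ) ≤ ((lam l₀ : ℕ) : ℝ) := by exact_mod_cast hlam_ge l₀
      have hp0 : (0 : ℝ) ≤ ((d 1 - d 0 : ℕ) : ℝ) := Nat.cast_nonneg _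
      rcases hkind with hl00 | hpole
      · -- slow pair: λ = p exactly, any signs; strictness from `6ψ₁² > 0`
        subst hl00
        have hlam00 : ((lam 0 : ℕ) : ℝ) = ((d 1 - d 0 : ℕ) : ℝ) := by
          show (((d (0 : Fin (n + 1)).succ - d 0 : ℕ)) : ℝ) = ((d 1 - d 0 : ℕ) : ℝ)
          rfl
        rw [hlam00] at hlaw
        have hψ : rowPsiK1 lam (a j 0) (fun l : Fin (n + 1) => -(a j l.succ)) x ≠ 0 := by
          rcases lt_or_gt_of_ne (mul_ne_zero h0 (neg_ne_zero.2 hl0) : a j 0 * -(a j (0 : Fin (n + 1)).succ) ≠ 0) with hneg | hpos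
          · exact (rowPsiK1_single_neg lam (a j 0) (fun l : Fin (n + 1) => -(a j l.succ)) 0 hB hx0 (hlam_ne 0) hneg hF).ne
          · exact (rowPsiK1_single_pos lam (a j 0) (fun l : Fin (n + 1) => -(a j l.succ)) 0 hB hx0 (hlam_ne 0) hpos hF).ne'
        have hsq : 0 < rowPsiK1 lam (a j 0) (fun l : Fin (n + 1) => -(a j l.succ)) x ^ 2 := by positivity
        linarith
      · -- pole on the pair (d 0, d l₀.succ): `ψ₁ > 0`, rate `≥ p`
        have hAB : 0 < a j 0 * (fun l : Fin (n + 1) => -(a j l.succ)) l₀ := by simp only; nlinarith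
        have hψ : 0 < rowPsiK1 lam (a j 0) (fun l : Fin (n + 1) => -(a j l.succ)) x :=
          rowPsiK1_single_pos lam (a j 0) (fun l : Fin (n + 1) => -(a j l.succ)) l₀ hB hx0 (hlam_ne l₀) hAB hF
        have hsq : 0 < rowPsiK1 lam (a j 0) (fun l : Fin (n + 1) => -(a j l.succ)) x ^ 2 := by positivity
        have hpq : ((d 1 - d 0 : ℕ) : ℝ) ^ 2 ≤ ((lam l₀ : ℕ) : ℝ) ^ 2 := by nlinarith
        nlinarith
    · -- (C) unswitched incoherent K-nomial
      have hB0 : ∀ l, 0 ≤ (fun l : Fin (n + 1) => -(a j l.succ)) l := fun l => by simp only; linarith [hle l]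
      have hposg : 0 < a j 0 - ∑ l : Fin (n + 1), (-(a j l.succ)) * x ^ (lam l) := by
        rw [hev] at hvpos
        have h3 : 0 < a j 0 - ∑ l : Fin (n + 1), (-(a j l.succ)) * v ^ (lam l) := (mul_pos_iff_of_pos_left (pow_pos hv _)).1 hvpos
        have hmono : ∑ l : Fin (n + 1), (-(a j l.succ)) * x ^ (lam l) ≤ ∑ l : Fin (n + 1), (-(a j l.succ)) * v ^ (lam l) :=
          Finset.sum_le_sum fun l _ => mul_le_mul_of_nonneg_left (pow_le_pow_left₀ hx0.le hx.2.le _) (hB0 l)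
        linarith
      refine ⟨hposg.ne', ?_⟩
      have hH1 : 0 < rowHK lam 1 (fun l : Fin (n + 1) => -(a j l.succ)) x := by
        obtain ⟨l₁, hl₁⟩ : ∃ l : Fin (n + 1), a j l.succ < 0 := by
          by_contra hcon
          push Not at hcon
          have : ∑ l : Fin (n + 1), a j l.succ = 0 :=
            Finset.sum_eq_zero fun l _ => le_antisymm (hle l) (hcon l)
          linarith
        unfold rowHK
        refine Finset.sum_pos' (fun l _ => mul_nonneg (mul_nonneg (by positivity) (hB0 l)) (pow_pos hx0 _).le)
          ⟨l₁, Finset.mem_univ _, ?_⟩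
        have hl1 : (0 : ℝ) < ((lam l₁ : ℕ) : ℝ) := by exact_mod_cast Nat.pos_of_ne_zero (hlam_ne l₁)
        simp only [pow_one]
        exact mul_pos (mul_pos hl1 (by linarith)) (pow_pos hx0 _)
      exact rowPsiK3_gt lam (a j 0) (fun l : Fin (n + 1) => -(a j l.succ)) (d 1 - d 0) hx0 hB0 hlam_ge hposg hH1
  -- no row vanishes on the window
  have hf : ∀ x ∈ Ioo u v, ∀ j, (∑ l, C (a j l) * X ^ (d l) : ℝ[X]).eval x ≠ 0 := by
    intro x hx j
    rw [hev]
    exact mul_ne_zero (pow_ne_zero _ (hu.trans hx.1).ne') (hkey j x hx).1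
  -- at a root of `W(P)` in the window the slopes sum to zero
  have hsum : ∀ x ∈ ({x₁, x₂, x₃} : Set ℝ), ∑ j, rowPsiK1 lam (a j 0) (fun l : Fin (n + 1) => -(a j l.succ)) x = 0 := by
    intro x hx
    have hxI := hIoo x hx
    have hx0 : 0 < x := hu.trans hxI.1
    have h := hzero x hx
    rw [logWronskian_prodK_eq_rowPsiK1_sum d hd0 a hx0 (hf x hxI)] at h
    have hP : ((∏ j, (∑ l, C (a j l) * X ^ (d l) : ℝ[X])).eval x) ≠ 0 := by
      rw [eval_prod]; exact Finset.prod_ne_zero_iff.2 fun j _ => hf x hxI j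
    rcases mul_eq_zero.1 h with h1 | h1
    · exact absurd (neg_eq_zero.1 h1) (pow_ne_zero 2 hP)
    · exact h1
  -- the θ-shell with exponent `n + 1 = d 1 − d 0`
  refine no_three_zeros_of_theta_sq_law (d 1 - d 0 - 1) hu.le
    (S := fun x => ∑ j, rowPsiK1 lam (a j 0) (fun l : Fin (n + 1) => -(a j l.succ)) x)
    (S₁ := fun x => ∑ j, rowPsiK2 lam (a j 0) (fun l : Fin (n + 1) => -(a j l.succ)) x)
    (S₂ := fun x => ∑ j, rowPsiK3 lam (a j 0) (fun l : Fin (n + 1) => -(a j l.succ)) x)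
    ?_ ?_ ?_ h₁ h₃ h12' h23 (hsum x₁ (by simp)) (hsum x₂ (by simp)) (hsum x₃ (by simp))
  · intro x hx
    have hx0 : x ≠ 0 := (hu.trans hx.1).ne'
    have h := HasDerivAt.fun_sum (u := Finset.univ)
      (fun j _ => hasDerivAt_rowPsiK1 lam (a j 0) (fun l : Fin (n + 1) => -(a j l.succ)) hx0 (hkey j x hx).1)
    simpa only [Finset.sum_div] using h
  · intro x hx
    have hx0 : x ≠ 0 := (hu.trans hx.1).ne'
    have h := HasDerivAt.fun_sum (u := Finset.univ)
      (fun j _ => hasDerivAt_rowPsiK2 lam (a j 0) (fun l : Fin (n + 1) => -(a j l.succ)) hx0 (hkey j x hx).1)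
    simpa only [Finset.sum_div] using h
  · intro x hx
    rw [hcast, Finset.mul_sum]
    exact Finset.sum_lt_sum (fun j _ => (hkey j x hx).2.le) ⟨⟨0, hm⟩, Finset.mem_univ _, (hkey _ x hx).2⟩

/-- ★★ **THE RATE-FREE SLOW-KNEE CELL FOR EVERY K**: under the menu of `slowKneeCellEveryK_wronskian_no_three_zeros` (any `m`), `W(∏_j f_j)` has AT MOST
TWO roots in `(u,v)`. [this file's theorem] -/
theorem slowKneeCellEveryK_wronskian_roots_le_two {m n : ℕ} (d : Fin (n + 2) → ℕ) (hd : StrictMono d)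
    (a : Fin m → Fin (n + 2) → ℝ) {u v : ℝ} (hu : 0 < u)
    (hrow : ∀ j,
      (∃ l₀ : Fin (n + 1), (∀ l, l ≠ l₀ → a j l.succ = 0) ∧ a j 0 ≠ 0 ∧ a j l₀.succ ≠ 0 ∧ (l₀ = 0 ∨ a j 0 * a j l₀.succ < 0) ∧
          0 ≤ (∑ l, C (a j l) * X ^ (d l) : ℝ[X]).eval u * (∑ l, C (a j l) * X ^ (d l) : ℝ[X]).eval v) ∨
      (0 < a j 0 ∧ (∀ l : Fin (n + 1), a j l.succ ≤ 0) ∧ ∑ l : Fin (n + 1), a j l.succ < 0 ∧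
          0 < (∑ l, C (a j l) * X ^ (d l) : ℝ[X]).eval v)) :
    (((∏ j, ∑ l, C (a j l) * X ^ (d l) : ℝ[X]) * (X * derivative (X * derivative (∏ j, ∑ l, C (a j l) * X ^ (d l) : ℝ[X])))
        - (X * derivative (∏ j, ∑ l, C (a j l) * X ^ (d l) : ℝ[X])) ^ 2).roots.toFinset.filter (fun t => u < t ∧ t < v)).card ≤ 2 := by
  classical
  set W : ℝ[X] := (∏ j, ∑ l, C (a j l) * X ^ (d l) : ℝ[X]) * (X * derivative (X * derivative (∏ j, ∑ l, C (a j l) * X ^ (d l) : ℝ[X])))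
      - (X * derivative (∏ j, ∑ l, C (a j l) * X ^ (d l) : ℝ[X])) ^ 2 with hWdef
  by_contra hgt
  push Not at hgt
  obtain ⟨y₁, hy₁, y₂, hy₂, y₃, hy₃, h12', h23⟩ := exists_three_lt_of_card (T := W.roots.toFinset.filter (fun t => u < t ∧ t < v)) hgt
  by_cases hW0 : W = 0
  · rw [hW0, roots_zero, Multiset.toFinset_zero, Finset.filter_empty] at hy₁; exact absurd hy₁ (Finset.notMem_empty _)
  have hm : 0 < m := by
    rcases Nat.eq_zero_or_pos m with h0 | hpos
    · subst h0
      exact absurd (by rw [hWdef]; simp) hW0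
    · exact hpos
  rw [mem_filter, Multiset.mem_toFinset, mem_roots hW0] at hy₁ hy₂ hy₃
  refine slowKneeCellEveryK_wronskian_no_three_zeros hm d hd a hu hrow (x₁ := y₁) (x₂ := y₂) (x₃ := y₃)
    hy₁.2 hy₃.2 h12' h23 ?_
  intro x hx
  simp only [Set.mem_insert_iff, Set.mem_singleton_iff] at hx
  rcases hx with h | h | h <;> subst h
  · exact hy₁.1
  · exact hy₂.1
  · exact hy₃.1

/-- No menu row vanishes on the window (every K). [this file's lemma] -/
theorem slowKneeCellEveryK_eval_ne_zero {m n : ℕ} (d : Fin (n + 2) → ℕ) (hd : StrictMono d)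
    (a : Fin m → Fin (n + 2) → ℝ) {u v : ℝ} (hu : 0 < u)
    (hrow : ∀ j,
      (∃ l₀ : Fin (n + 1), (∀ l, l ≠ l₀ → a j l.succ = 0) ∧ a j 0 ≠ 0 ∧ a j l₀.succ ≠ 0 ∧ (l₀ = 0 ∨ a j 0 * a j l₀.succ < 0) ∧
          0 ≤ (∑ l, C (a j l) * X ^ (d l) : ℝ[X]).eval u * (∑ l, C (a j l) * X ^ (d l) : ℝ[X]).eval v) ∨
      (0 < a j 0 ∧ (∀ l : Fin (n + 1), a j l.succ ≤ 0) ∧ ∑ l : Fin (n + 1), a j l.succ < 0 ∧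
          0 < (∑ l, C (a j l) * X ^ (d l) : ℝ[X]).eval v))
    {x : ℝ} (hx : x ∈ Ioo u v) (j : Fin m) : (∑ l, C (a j l) * X ^ (d l) : ℝ[X]).eval x ≠ 0 := by
  classical
  have hd0 : ∀ l, d 0 ≤ d l := fun l => hd.monotone (Fin.zero_le l)
  set lam : Fin (n + 1) → ℕ := fun l => d l.succ - d 0 with hlam
  have hlam_ne : ∀ l : Fin (n + 1), lam l ≠ 0 := by
    intro l
    have : d 0 < d l.succ := hd (by rw [Fin.lt_def]; simp)
    show d l.succ - d 0 ≠ 0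
    omega
  have hv : 0 < v := hu.trans (hx.1.trans hx.2)
  have hx0 : 0 < x := hu.trans hx.1
  have hev : ∀ x, (∑ l, C (a j l) * X ^ (d l) : ℝ[X]).eval x
      = x ^ (d 0) * (a j 0 - ∑ l : Fin (n + 1), (-(a j l.succ)) * x ^ (lam l)) := fun x => eval_rowK_eq d hd0 (a j) x
  rw [hev]
  refine mul_ne_zero (pow_ne_zero _ hx0.ne') ?_
  rcases hrow j with ⟨l₀, hzero', h0, hl0, -, hend⟩ | ⟨h0, hle, -, hvpos⟩
  · have hB : ∀ l, l ≠ l₀ → (fun l : Fin (n + 1) => -(a j l.succ)) l = 0 := fun l hl => by simp [hzero' l hl]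
    have hrs := row_single lam (a j 0) (fun l : Fin (n + 1) => -(a j l.succ)) l₀ hB
    have hgu : (∑ l, C (a j l) * X ^ (d l) : ℝ[X]).eval u = u ^ (d 0) * (a j 0 + a j l₀.succ * u ^ (lam l₀)) := by
      rw [hev, row_single lam (a j 0) (fun l : Fin (n + 1) => -(a j l.succ)) l₀ hB]; ring
    have hgv : (∑ l, C (a j l) * X ^ (d l) : ℝ[X]).eval v = v ^ (d 0) * (a j 0 + a j l₀.succ * v ^ (lam l₀)) := by
      rw [hev, row_single lam (a j 0) (fun l : Fin (n + 1) => -(a j l.succ)) l₀ hB]; ring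
    have hend' : 0 ≤ (a j 0 + a j l₀.succ * u ^ (lam l₀)) * (a j 0 + a j l₀.succ * v ^ (lam l₀)) := by
      rw [hgu, hgv] at hend
      have hpow : 0 < u ^ (d 0) * v ^ (d 0) := mul_pos (pow_pos hu _) (pow_pos hv _)
      have : u ^ (d 0) * (a j 0 + a j l₀.succ * u ^ (lam l₀)) * (v ^ (d 0) * (a j 0 + a j l₀.succ * v ^ (lam l₀)))
          = (u ^ (d 0) * v ^ (d 0)) * ((a j 0 + a j l₀.succ * u ^ (lam l₀)) * (a j 0 + a j l₀.succ * v ^ (lam l₀))) := by ring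
      rw [this] at hend
      exact (mul_nonneg_iff_of_pos_left hpow).1 hend
    have hne := binomial_ne_zero_of_endpoints (a j 0) (a j l₀.succ) (hlam_ne l₀) hu hx hend' hl0
    rw [hrs]
    have : a j 0 - -(a j l₀.succ) * x ^ (lam l₀) = a j 0 + a j l₀.succ * x ^ (lam l₀) := by ring
    rwa [this]
  · have hB0 : ∀ l, 0 ≤ (fun l : Fin (n + 1) => -(a j l.succ)) l := fun l => by simp only; linarith [hle l]
    rw [hev] at hvpos
    have h3 : 0 < a j 0 - ∑ l : Fin (n + 1), (-(a j l.succ)) * v ^ (lam l) := (mul_pos_iff_of_pos_left (pow_pos hv _)).1 hvpos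
    have hmono : ∑ l : Fin (n + 1), (-(a j l.succ)) * x ^ (lam l) ≤ ∑ l : Fin (n + 1), (-(a j l.succ)) * v ^ (lam l) :=
      Finset.sum_le_sum fun l _ => mul_le_mul_of_nonneg_left (pow_le_pow_left₀ hx0.le hx.2.le _) (hB0 l)
    exact ne_of_gt (by linarith)

/-- ★★ **THE EVERY-K CELL IN THE FLOOR'S CURRENCY**: for every coupling `l₀`, `eulerNumerator d a l₀` (unfolded) has AT MOST THREE zeros in `(u,v)`.
[this file's theorem] -/
theorem slowKneeCellEveryK_eulerNumerator_roots_le_three {m n : ℕ} (d : Fin (n + 2) → ℕ) (hd : StrictMono d)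
    (a : Fin m → Fin (n + 2) → ℝ) (l₀ : Fin (n + 2)) {u v : ℝ} (hu : 0 < u)
    (hrow : ∀ j,
      (∃ l₀ : Fin (n + 1), (∀ l, l ≠ l₀ → a j l.succ = 0) ∧ a j 0 ≠ 0 ∧ a j l₀.succ ≠ 0 ∧ (l₀ = 0 ∨ a j 0 * a j l₀.succ < 0) ∧
          0 ≤ (∑ l, C (a j l) * X ^ (d l) : ℝ[X]).eval u * (∑ l, C (a j l) * X ^ (d l) : ℝ[X]).eval v) ∨
      (0 < a j 0 ∧ (∀ l : Fin (n + 1), a j l.succ ≤ 0) ∧ ∑ l : Fin (n + 1), a j l.succ < 0 ∧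
          0 < (∑ l, C (a j l) * X ^ (d l) : ℝ[X]).eval v)) :
    ((∑ j, (∑ l, C (a j l * ((d l : ℝ) - d l₀)) * X ^ (d l)) * ∏ i ∈ Finset.univ.erase j, (∑ l, C (a i l) * X ^ (d l))
        : ℝ[X]).roots.toFinset.filter (fun t => u < t ∧ t < v)).card ≤ 3 := by
  classical
  refine roots_Ioo_card_le_of_Icc _ 3 fun u' v' hu' hv' => ?_
  rcases lt_or_ge v' u' with hvu | huv'
  · have : ((∑ j, (∑ l, C (a j l * ((d l : ℝ) - d l₀)) * X ^ (d l)) * ∏ i ∈ Finset.univ.erase j, (∑ l, C (a i l) * X ^ (d l))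
        : ℝ[X]).roots.toFinset.filter (fun t => u' ≤ t ∧ t ≤ v')) = ∅ :=
      Finset.filter_eq_empty_iff.2 fun t _ h => by linarith [h.1, h.2]
    rw [this]; simp
  have hu'0 : 0 < u' := hu.trans hu'
  have hP : ∀ t ∈ Set.Icc u' v', (∏ j, (∑ l, C (a j l) * X ^ (d l) : ℝ[X])).eval t ≠ 0 := by
    intro t ht
    rw [eval_prod]
    exact Finset.prod_ne_zero_iff.2 fun j _ =>
      slowKneeCellEveryK_eval_ne_zero d hd a hu hrow ⟨hu'.trans_le ht.1, ht.2.trans_lt hv'⟩ j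
  have h1 := eulerNumerator_roots_Icc_le_wronskian_roots_add_one d a l₀ hu'0 hP
  have h2 := slowKneeCellEveryK_wronskian_roots_le_two d hd a hu hrow
  have h3 : (((∏ j, ∑ l, C (a j l) * X ^ (d l) : ℝ[X]) * (X * derivative (X * derivative (∏ j, ∑ l, C (a j l) * X ^ (d l) : ℝ[X])))
            - (X * derivative (∏ j, ∑ l, C (a j l) * X ^ (d l) : ℝ[X])) ^ 2).roots.toFinset.filter (fun w => u' < w ∧ w < v')).card
      ≤ (((∏ j, ∑ l, C (a j l) * X ^ (d l) : ℝ[X]) * (X * derivative (X * derivative (∏ j, ∑ l, C (a j l) * X ^ (d l) : ℝ[X])))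
            - (X * derivative (∏ j, ∑ l, C (a j l) * X ^ (d l) : ℝ[X])) ^ 2).roots.toFinset.filter (fun t => u < t ∧ t < v)).card := by
    refine Finset.card_le_card fun t ht => ?_
    have ht' := Finset.mem_filter.1 ht
    exact Finset.mem_filter.2 ⟨ht'.1, hu'.trans ht'.2.1, ht'.2.2.trans hv'⟩
  omega

end ProductPlusOne

end Summit.ValiantsHypothesis.ValiantsHypothesis.Theorems.LacunarySymmetroidMatrixDescartes
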